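import Summits.Ventures.HodgeRepro2.T6GradedKunneth

/-!
# T6GradedKunnethInt — the antidiagonal form of the degree-`n` Künneth map and the integral of a Künneth class

Cell pub-hodge-repro2, Tier 6 (README §10), seat t6-p3 (A3 owner). Proof lane; carrier-free, Mathlib
only; companion of T6GradedKunneth (same setting and notation). Two things the instantiation on a host
carrier needs: (1) the degree-`n` Künneth map indexed by `Finset.antidiagonal n` (`kunnethMapAnti`, the
shape of the host's `kunnethMap`), with the reindexing equivalence `antidiagEquiv` and
`bijective_kunnethMap_iff`; (2) THE INTEGRAL OF A KÜNNETH CLASS (`int_crossAlgHom`): for functionals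
`intX`, `intY`, `intXY` killing all degrees but the top ones `dX`, `dY`, `dX + dY`, with the gradings
vanishing above their tops and the product orientation on the top bidegree,
`intXY (crossAlgHom w) = intPair intX intY w` for every `w` of the graded tensor product (step (c) of
the `int_evBB` discharge path, route/T6-A3-t6-p3.md §9); (0) two cast helpers (the Koszul rule of the
total ring from a degreewise `cup_comm`-shaped sign rule) and (3) the exterior grading of a
finite-dimensional space vanishes above the dimension (the `hXtop` / `hYtop` hypotheses on `⋀ H¹`).

§8(d): uses an L-value-free non-vanishing device: NO.
-/

namespace Summit.Ventures.HodgeRepro2.T6.GradedKunneth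

open DirectSum
open scoped DirectSum TensorProduct

variable {R : Type*} [CommRing R]
variable {𝒞 : ℕ → Type*} [∀ i, AddCommGroup (𝒞 i)] [∀ i, Module R (𝒞 i)] [GRing 𝒞] [GAlgebra R 𝒞]
variable {A B : Type*} [Ring A] [Ring B] [Algebra R A] [Algebra R B]
variable {𝒜 : ℕ → Submodule R A} {ℬ : ℕ → Submodule R B}
  {ιX : A →ₐ[R] ⨁ i, 𝒞 i} {ιY : B →ₐ[R] ⨁ i, 𝒞 i}

/-! ## 0. Two cast helpers for the instantiation (the Koszul rule from a degreewise sign rule) -/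

omit [GRing 𝒞] in
/-- Transport of a homogeneous element along an equality of degrees, under `of`. -/
theorem of_cast {m n : ℕ} (h : m = n) (x : 𝒞 m) :
    of 𝒞 n (cast (congrArg 𝒞 h) x) = of 𝒞 m x := by
  subst h
  rfl

/-- The sign rule of the total ring (`anti_commutes`'s `hsign`) from the DEGREEWISE Koszul rule of the
graded multiplication, stated with the cast `𝒞 (j + i) → 𝒞 (i + j)` — the shape of a host carrier's
`cup_comm` (`cup h a b = (−1)^{ij} • cup h' b a`). -/
theorem hsign_of_gmul_comm
    (hc : ∀ (i j : ℕ) (x : 𝒞 i) (y : 𝒞 j), GradedMonoid.GMul.mul x y =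
      ((-1 : ℤˣ) ^ (j * i)) • cast (congrArg 𝒞 (add_comm j i)) (GradedMonoid.GMul.mul y x)) :
    ∀ (i j : ℕ) (x : 𝒞 i) (y : 𝒞 j),
      of 𝒞 i x * of 𝒞 j y = ((-1 : ℤˣ) ^ (j * i)) • (of 𝒞 j y * of 𝒞 i x) := by
  intro i j x y
  rw [DirectSum.of_mul_of, DirectSum.of_mul_of, hc, Units.smul_def, Units.smul_def, map_zsmul,
    of_cast (add_comm j i)]

/-! ## 1. The antidiagonal-indexed form of the degree-`n` Künneth map -/

section antidiag

variable {M : ℕ × ℕ → Type*} [∀ ij, AddCommGroup (M ij)] [∀ ij, Module R (M ij)]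

/-- Reindexing `⨁_{i+j=n} M (i,j) → ⨁_{(p,q) ∈ antidiagonal n} M (p,q)`. -/
noncomputable def toAntidiag (n : ℕ) :
    (⨁ s : {ij : ℕ × ℕ // totalDeg ij = n}, M s.1) →ₗ[R]
      ⨁ pq : Finset.HasAntidiagonal.antidiagonal n, M pq.1 :=
  DirectSum.toModule R _ _ fun s =>
    DirectSum.lof R (Finset.HasAntidiagonal.antidiagonal n) (fun pq => M pq.1)
      ⟨s.1, Finset.HasAntidiagonal.mem_antidiagonal.mpr s.2⟩

/-- The inverse reindexing. -/
noncomputable def ofAntidiag (n : ℕ) :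
    (⨁ pq : Finset.HasAntidiagonal.antidiagonal n, M pq.1) →ₗ[R]
      ⨁ s : {ij : ℕ × ℕ // totalDeg ij = n}, M s.1 :=
  DirectSum.toModule R _ _ fun pq =>
    DirectSum.lof R {ij : ℕ × ℕ // totalDeg ij = n} (fun s => M s.1)
      ⟨pq.1, Finset.HasAntidiagonal.mem_antidiagonal.mp pq.2⟩

/-- `ofAntidiag ∘ toAntidiag = id`. -/
theorem ofAntidiag_comp_toAntidiag (n : ℕ) :
    (ofAntidiag (M := M) (R := R) n).comp (toAntidiag (M := M) (R := R) n) = LinearMap.id := by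
  classical
  apply DirectSum.linearMap_ext
  rintro ⟨⟨i, j⟩, hs⟩
  refine LinearMap.ext fun w => ?_
  simp only [LinearMap.comp_apply, toAntidiag, ofAntidiag, DirectSum.toModule_lof, LinearMap.id_apply]

/-- `toAntidiag ∘ ofAntidiag = id`. -/
theorem toAntidiag_comp_ofAntidiag (n : ℕ) :
    (toAntidiag (M := M) (R := R) n).comp (ofAntidiag (M := M) (R := R) n) = LinearMap.id := by
  classical
  apply DirectSum.linearMap_ext
  rintro ⟨⟨i, j⟩, hs⟩
  refine LinearMap.ext fun w => ?_
  simp only [LinearMap.comp_apply, toAntidiag, ofAntidiag, DirectSum.toModule_lof, LinearMap.id_apply]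

/-- The reindexing as a linear equivalence. -/
noncomputable def antidiagEquiv (n : ℕ) :
    (⨁ s : {ij : ℕ × ℕ // totalDeg ij = n}, M s.1) ≃ₗ[R]
      ⨁ pq : Finset.HasAntidiagonal.antidiagonal n, M pq.1 :=
  LinearEquiv.ofLinear (toAntidiag (M := M) (R := R) n) (ofAntidiag (M := M) (R := R) n)
    (toAntidiag_comp_ofAntidiag n) (ofAntidiag_comp_toAntidiag n)

/-- `antidiagEquiv` on a summand. -/
theorem antidiagEquiv_lof (n : ℕ) (s : {ij : ℕ × ℕ // totalDeg ij = n}) (w : M s.1) :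
    antidiagEquiv (M := M) (R := R) n
        (DirectSum.lof R _ (fun s : {ij : ℕ × ℕ // totalDeg ij = n} => M s.1) s w) =
      DirectSum.lof R (Finset.HasAntidiagonal.antidiagonal n) (fun pq => M pq.1)
        ⟨s.1, Finset.HasAntidiagonal.mem_antidiagonal.mpr s.2⟩ w := by
  simp only [antidiagEquiv, LinearEquiv.ofLinear_apply, toAntidiag, DirectSum.toModule_lof]

/-- `antidiagEquiv.symm` on a summand. -/
theorem antidiagEquiv_symm_lof (n : ℕ) (pq : Finset.HasAntidiagonal.antidiagonal n) (w : M pq.1) :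
    (antidiagEquiv (R := R) n).symm
        (DirectSum.lof R (Finset.HasAntidiagonal.antidiagonal n) (fun pq => M pq.1) pq w) =
      DirectSum.lof R _ (fun s : {ij : ℕ × ℕ // totalDeg ij = n} => M s.1)
        ⟨pq.1, Finset.HasAntidiagonal.mem_antidiagonal.mp pq.2⟩ w := by
  simp only [antidiagEquiv, LinearEquiv.ofLinear_symm_apply, ofAntidiag, DirectSum.toModule_lof]

end antidiag

/-- The degree-`n` Künneth map indexed by the antidiagonal,
`⨁_{(p,q) ∈ antidiagonal n} 𝒜 p ⊗ ℬ q → 𝒞 n` — the shape of the host's `kunnethMap`. -/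
noncomputable def kunnethMapAnti (HX : HomogeneousAlgHom 𝒜 ιX) (HY : HomogeneousAlgHom ℬ ιY)
    (n : ℕ) :
    (⨁ pq : Finset.HasAntidiagonal.antidiagonal n, 𝒜 pq.1.1 ⊗[R] ℬ pq.1.2) →ₗ[R] 𝒞 n :=
  (kunnethMap HX HY n).comp
    (antidiagEquiv (M := fun ij => 𝒜 ij.1 ⊗[R] ℬ ij.2) (R := R) n).symm.toLinearMap

/-- `kunnethMapAnti n` on a summand: the piece map, transported to degree `n`. -/
theorem kunnethMapAnti_lof (HX : HomogeneousAlgHom 𝒜 ιX) (HY : HomogeneousAlgHom ℬ ιY) (n : ℕ)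
    (pq : Finset.HasAntidiagonal.antidiagonal n) (w : 𝒜 pq.1.1 ⊗[R] ℬ pq.1.2) :
    kunnethMapAnti HX HY n (DirectSum.lof R (Finset.HasAntidiagonal.antidiagonal n)
      (fun pq => 𝒜 pq.1.1 ⊗[R] ℬ pq.1.2) pq w) =
      DirectSumInj.castN (R := R) (N := 𝒞) (Finset.HasAntidiagonal.mem_antidiagonal.mp pq.2)
        (pieceMap HX HY pq.1 w) := by
  rw [kunnethMapAnti, LinearMap.comp_apply, LinearEquiv.coe_coe, antidiagEquiv_symm_lof,
    kunnethMap_lof]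
  rfl

/-- Bijectivity of the two forms of the degree-`n` Künneth map agree. -/
theorem bijective_kunnethMap_iff (HX : HomogeneousAlgHom 𝒜 ιX) (HY : HomogeneousAlgHom ℬ ιY)
    (n : ℕ) :
    Function.Bijective (kunnethMap HX HY n) ↔ Function.Bijective (kunnethMapAnti HX HY n) := by
  constructor
  · intro h
    exact h.comp (antidiagEquiv (M := fun ij => 𝒜 ij.1 ⊗[R] ℬ ij.2) (R := R) n).symm.bijective
  · intro h
    have : kunnethMap HX HY n = (kunnethMapAnti HX HY n).comp
        (antidiagEquiv (M := fun ij => 𝒜 ij.1 ⊗[R] ℬ ij.2) (R := R) n).toLinearMap := by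
      rw [kunnethMapAnti, LinearMap.comp_assoc]
      simp
    rw [this]
    exact h.comp (antidiagEquiv (M := fun ij => 𝒜 ij.1 ⊗[R] ℬ ij.2) (R := R) n).bijective

/-- The antidiagonal-indexed Künneth map DIRECTLY as `DirectSum.toModule` over the antidiagonal — the
host's `kunnethMap` shape (`lof pq w ↦ castN (pieceMap pq w)`), so that an instantiation can compare
the two by `DirectSum.linearMap_ext` summand by summand. -/
noncomputable def kunnethMapAnti' (HX : HomogeneousAlgHom 𝒜 ιX) (HY : HomogeneousAlgHom ℬ ιY)
    (n : ℕ) :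
    (⨁ pq : Finset.HasAntidiagonal.antidiagonal n, 𝒜 pq.1.1 ⊗[R] ℬ pq.1.2) →ₗ[R] 𝒞 n :=
  DirectSum.toModule R _ _ fun pq =>
    (DirectSumInj.castN (R := R) (N := 𝒞) (Finset.HasAntidiagonal.mem_antidiagonal.mp pq.2)).comp
      (pieceMap HX HY pq.1)

/-- The two antidiagonal forms agree. -/
theorem kunnethMapAnti_eq (HX : HomogeneousAlgHom 𝒜 ιX) (HY : HomogeneousAlgHom ℬ ιY) (n : ℕ) :
    kunnethMapAnti HX HY n = kunnethMapAnti' HX HY n := by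
  classical
  apply DirectSum.linearMap_ext
  intro pq
  refine LinearMap.ext fun w => ?_
  rw [LinearMap.comp_apply, LinearMap.comp_apply, kunnethMapAnti_lof, kunnethMapAnti',
    DirectSum.toModule_lof, LinearMap.comp_apply]
  rfl

/-- Bijectivity of the degree-`n` Künneth map in the host's shape. -/
theorem bijective_kunnethMap_iff' (HX : HomogeneousAlgHom 𝒜 ιX) (HY : HomogeneousAlgHom ℬ ιY)
    (n : ℕ) :
    Function.Bijective (kunnethMap HX HY n) ↔ Function.Bijective (kunnethMapAnti' HX HY n) := by
  rw [bijective_kunnethMap_iff, kunnethMapAnti_eq]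

/-! ## 2. The integral of a Künneth class -/

section int

variable [GradedAlgebra 𝒜] [GradedAlgebra ℬ]

/-- The pairing of two functionals on the graded tensor product: `intPair intX intY (a ⊗ b) =
intX a * intY b` (the shape of the interface's `OfData.intBBOf`). -/
noncomputable def intPair (intX : A →ₗ[R] R) (intY : B →ₗ[R] R) :
    GradedTensorProduct R 𝒜 ℬ →ₗ[R] R :=
  (TensorProduct.lift ((LinearMap.mul R R).compl₁₂ intX intY)).comp
    (GradedTensorProduct.of R 𝒜 ℬ).symm.toLinearMap

/-- `intPair intX intY (a ⊗ b) = intX a * intY b`. -/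
theorem intPair_tmul (intX : A →ₗ[R] R) (intY : B →ₗ[R] R) (a : A) (b : B) :
    intPair (𝒜 := 𝒜) (ℬ := ℬ) intX intY (GradedTensorProduct.tmul R a b) = intX a * intY b := by
  simp [intPair, GradedTensorProduct.tmul]

/-- `intPair` through `of`. -/
theorem intPair_of (intX : A →ₗ[R] R) (intY : B →ₗ[R] R) (u : A ⊗[R] B) :
    intPair (𝒜 := 𝒜) (ℬ := ℬ) intX intY (GradedTensorProduct.of R 𝒜 ℬ u) =
      TensorProduct.lift ((LinearMap.mul R R).compl₁₂ intX intY) u := rfl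

variable (HX : HomogeneousAlgHom 𝒜 ιX) (HY : HomogeneousAlgHom ℬ ιY)
  (intX : A →ₗ[R] R) (intY : B →ₗ[R] R) (intXY : (⨁ i, 𝒞 i) →ₗ[R] R) (dX dY : ℕ)
  (hXdeg : ∀ n, n ≠ dX → ∀ a ∈ 𝒜 n, intX a = 0)
  (hYdeg : ∀ n, n ≠ dY → ∀ b ∈ ℬ n, intY b = 0)
  (hXtop : ∀ n, dX < n → ∀ a ∈ 𝒜 n, a = 0)
  (hYtop : ∀ n, dY < n → ∀ b ∈ ℬ n, b = 0)
  (hXYdeg : ∀ n, n ≠ dX + dY → ∀ z : 𝒞 n, intXY (of 𝒞 n z) = 0)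
  (hProd : ∀ a ∈ 𝒜 dX, ∀ b ∈ ℬ dY, intXY (ιX a * ιY b) = intX a * intY b)

include HX HY hXdeg hYdeg hXtop hYtop hXYdeg hProd in
/-- The integral of a product `ιX a * ιY b` is `intX a * intY b` for ALL `a`, `b`: homogeneous pieces
off the top bidegree vanish on both sides by degree, the top bidegree is the product orientation. -/
theorem int_cross (a : A) (b : B) : intXY (ιX a * ιY b) = intX a * intY b := by
  induction a using DirectSum.Decomposition.inductionOn (ℳ := 𝒜) generalizing b with
  | zero => simp
  | add a a' ha ha' => simp only [map_add, add_mul, ha b, ha' b]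
  | homogeneous a =>
    rename_i i
    induction b using DirectSum.Decomposition.inductionOn (ℳ := ℬ) with
    | zero => simp
    | add b b' hb hb' => simp only [map_add, mul_add, hb, hb']
    | homogeneous b =>
      rename_i j
      by_cases hij : i = dX ∧ j = dY
      · obtain ⟨rfl, rfl⟩ := hij
        exact hProd a a.2 b b.2
      · have hR : intX a * intY b = 0 := by
          by_cases hi : i = dX
          · subst hi
            have hj : j ≠ dY := fun h => hij ⟨rfl, h⟩
            rw [hYdeg j hj b b.2, mul_zero]
          · rw [hXdeg i hi a a.2, zero_mul]
        rw [hR]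
        rcases Nat.lt_or_ge dX i with hlt | hge
        · rw [hXtop i hlt a a.2, map_zero, zero_mul, map_zero]
        rcases Nat.lt_or_ge dY j with hlt' | hge'
        · rw [hYtop j hlt' b b.2, map_zero, mul_zero, map_zero]
        have hsum : i + j ≠ dX + dY := by omega
        rw [HX.eq, HY.eq, DirectSum.of_mul_of]
        exact hXYdeg (i + j) hsum _

include HX HY hXdeg hYdeg hXtop hYtop hXYdeg hProd in
/-- THE INTEGRAL OF A KÜNNETH CLASS: `intXY (crossAlgHom w) = intPair intX intY w` for every `w` of the
graded tensor product. -/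
theorem int_crossAlgHom
    (hcomm : ∀ ⦃i j : ℕ⦄ (a : 𝒜 i) (b : ℬ j), ιX a * ιY b = ((-1 : ℤˣ) ^ (j * i)) • (ιY b * ιX a))
    (w : GradedTensorProduct R 𝒜 ℬ) :
    intXY (crossAlgHom hcomm w) = intPair (𝒜 := 𝒜) (ℬ := ℬ) intX intY w := by
  rw [← (GradedTensorProduct.of R 𝒜 ℬ).apply_symm_apply w, crossAlgHom_of hcomm, intPair_of]
  induction (GradedTensorProduct.of R 𝒜 ℬ).symm w using TensorProduct.induction_on with
  | zero => simp
  | tmul a b =>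
    rw [crossLin_tmul, TensorProduct.lift.tmul, LinearMap.compl₁₂_apply, LinearMap.mul_apply']
    exact int_cross HX HY intX intY intXY dX dY hXdeg hYdeg hXtop hYtop hXYdeg hProd a b
  | add u v hu hv => rw [map_add, map_add, map_add, hu, hv]

end int

/-! ## 3. An instantiation helper: the exterior grading vanishes above the dimension -/

section ext

open scoped ExteriorAlgebra

variable {F V : Type*} [Field F] [AddCommGroup V] [Module F V] [FiniteDimensional F V]

/-- `⋀^n V = ⊥` for `n` above the dimension of `V` (`finrank ⋀^n V = (finrank V).choose n`). -/
theorem exteriorPower_eq_bot_of_finrank_lt {n : ℕ} (h : Module.finrank F V < n) :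
    (⋀[F]^n V : Submodule F (ExteriorAlgebra F V)) = ⊥ := by
  rw [← Submodule.finrank_eq_zero, exteriorPower.finrank_eq, Nat.choose_eq_zero_of_lt h]

/-- The `hXtop` / `hYtop` hypothesis of `int_cross` for the exterior grading of a finite-dimensional
space: every element of `⋀^n V` vanishes for `n > finrank V`. -/
theorem eq_zero_of_mem_exteriorPower_of_finrank_lt (n : ℕ) (h : Module.finrank F V < n)
    {a : ExteriorAlgebra F V} (ha : a ∈ (⋀[F]^n V : Submodule F (ExteriorAlgebra F V))) : a = 0 := by
  rw [exteriorPower_eq_bot_of_finrank_lt h, Submodule.mem_bot] at ha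
  exact ha

end ext

end Summit.Ventures.HodgeRepro2.T6.GradedKunneth
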